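import Summits.BirchSwinnertonDyer.Rank1Residual.ManinAdditive.IZeroStarInertiaLaws
import Summits.BirchSwinnertonDyer.Rank1Residual.ManinAdditive.RamanujanCut
import Summits.BirchSwinnertonDyer.Rank1Residual.ManinAdditive.NeronOmegaThree
import Literature.NumberTheory.EllipticCurves.Tamagawa
import HarnessLib
import HarnessLib.Audit.Tags

/-!
# Sketch-desc-g29 — cell bsd-f2-manin, seat -desc (descent / visibility lens), gen 29, MEMO-desc §54

THE GLOBAL SHADOW WAS A LOCAL ONE.  On the torsion-free `I₀*` class at `2` (class A, tree decl
`ConwayCut.IsTorsionFreeIZeroStarAtTwo`) the PLAIN Conway defect `σ₂ := ord₂ deg φ − ord₂ [e_f S^G : ℤ f]` is decided by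
two `ℚ₂`-LOCAL data of the Néron model at `2` — the identity component carries a `ℚ₂`-rational point of order `2`
(Kosters–Pannekoek class «always», arXiv:1703.07888 Thm 1 / Cor 2) AND the component group has no `𝔽₂`-rational
non-identity point (`c₂ = 1`) — and NOT by the global data (Mordell–Weil rank, Tamagawa excess) of MEMO-desc §23–24:
census (three E-blind engines, 0 disagreements on 457 common rows: desc MS-0 g6 rev 5 incl. the NEW level 848 run in this
seat; data seat sigma.gp v2 `SIGMA-rows-v2-part1.tsv`; imc ENGINE 6 `neronconway7.gp` kit j312050/j312398/j312405) on ALL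
73 class-A optimal curves with `σ₂` known, `N ≤ 1632`:  `σ₂ = 0 ⟺ (E⁰(ℚ₂)[2] ≠ 0 ∧ c₂ = 1)`, **15 : 58, 0 exceptions**
(E-desc-g29-1).  The same local cell with «`c₂ = 1` OR the identity-component 2-torsion point is `ℚ`-rational» gives the
one-sided FULL law on all `I₀*` curves (E-desc-g29-2, 21/21, subsuming g6's E-desc-31), and its complement on class A the
DEFECT law (E-desc-g29-3, 58/58).  GLUE `classA_dichotomy_of_laws` PROVED.

NEGATIVE KNOWLEDGE (in-engine refutations recorded in MEMO-desc §54.2; the decls stay in the tree as settled negative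
edges, never re-filed): `ConwayCut.ResidualRankDefectLawAtTwo` / `…'` (E-desc-44/44′), `ConwayCut.ClassAGlobalDefectLawAtTwo`,
the `⟹` half of `ConwayCut.TorsionFreeIZeroStarDichotomyAtTwo` (E-desc-50) — witness **848f1** (`N = 2⁴·53`, class size 1,
`I₀*`, `E(ℚ)_tors = 0`, rank 1, `c₂ = 1`, `e₂ = 6`, `deg φ = 48`, `r_G = 48`: `σ₂ = 0`; three engines), likewise 976c1,
1264f1, 1424d1 (two engines); `ConwayCut.ImprimitiveTightIZeroStarFullLawAtTwo` (E-desc-49) — witness **1472f1**, 1472l1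
(`N = 2⁶·23`, `e₂ = 6`, rank 0, `∏c = 1`, tors 1, `σ₂ = 1`; ONE engine, imc ENGINE 6 partial-1831; second engine asked).
The repaired rank law on the `Φ`-class (rational 2-torsion, none of it in `E⁰(ℚ₂)`) is E-desc-g29-4 (28/28 on `I₀*`).

In imc's Néron-facing currency `σ₂^R` (end-saturated lattice `S^{G,R}`, `NeronConwayR.endSaturatedConwayLattice`,
E-imc-131) class A is uniformly DEFECT (72/72): the local cell of E-desc-g29-1 is exactly the set of class-A curves whose
missing halving is cut by `R₄ = t_{1/4} + t_{3/4}` and not by `⟨w_Q, t_{1/2}⟩` («NEWDEFECT», Rgain = 1: 15/15).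

At `3`: on the residual class (IV* at `3` with rational 3-torsion through `Φ₃`, 9 rows to `N = 918`) full depth is
EXACTLY 3-tightness (E-desc-g29-5, 5 : 4; rank and Tamagawa excess coincide on the defect side, so E-desc-45 is not
separated from its Tamagawa twin); `σ₃` is constant on `ℚ₃^{nr}`-isomorphism classes of optimal curves (484 rows,
39 non-trivial classes, 0 mixed), `σ₂` is not (4 mixed classes of 63, all in the `Φ`-class: F-desc-NL).

PARTITION currency ladder-live · beyond-print theorem: NO · BSD is not proved by this · Manin's conjecture is not proved
by this · W-71 respected (nothing filed; typed rows for -ty / -ref).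

TYPER NOTE (typer g21, T-desc-g29-2 + T-desc-g29-1).  SOURCE = HOME/desc/g29/Sketch-desc-g29.lean sha16 ac3f60d687c6bab1 (265 l.; desc g29:
farm rc 0·0·0·0; the sha ref1 audited in §R224 — A1 rc 0·0·0, 4 glue std, junk audit «`tamagawaNumberAtTwo ≠ 0` provable; minimal-model /
closure readings junk-free»; **REF1 §R224: rows E-desc-g29-1…5 SURVIVE**) VERBATIM, with exactly these deltas: namespace `…ManinAdditive.DescG29`
→ `…ManinAdditive.LocalCell` (named for the mathematics — the ℚ_p-LOCAL cells deciding the Conway defect — like every ManinAdditive leaf;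
the rows read `LocalCell.ClassATwoAdicDichotomyAtTwo`, …); this note.  Route-independent LEAF: imports the cone-free leaves
`IZeroStarInertiaLaws` / `RamanujanCut` / `NeronOmegaThree` + Literature `Tamagawa` (cone BFS 05:4xZ: no `Theses.*` in the closure);
rows `@[conjecture]` (NOTHING asserted), vocabulary defs with bodies (`minimalModelAtTwo`, `HasLocalTwoTorsionInIdentityComponentAtTwo`,
`tamagawaNumberAtTwo`, `IsClassAFullCellAtTwo`, `IsThreeTight` — E-facing, over Mathlib `WeierstrassCurve.minimal` / `goodReductionSubgroup`
and the tree's `localTamagawaNumber`), four PROVED glue theorems; the one typed debt ref1 names is the `hloc` bridge hypothesis of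
`full_of_rational_identity_torsion` (ℚ-rational identity-component 2-torsion ⟹ ℚ₂-local; routine base change, not proved here).
T-desc-g29-1 (NEGATIVE KNOWLEDGE): the paragraph above IS the tree record of the in-engine refutations of
`ConwayCut.ResidualRankDefectLawAtTwo` / `…'` (E-desc-44/44′, `ConwayKodairaLaws.lean`), `ConwayCut.ClassAGlobalDefectLawAtTwo` and the ⟹ half
of `ConwayCut.TorsionFreeIZeroStarDichotomyAtTwo` (E-desc-50, `IZeroStarInertiaLaws.lean`) at 848f1 (three engines + ref1 kit j338737, §R224
CONCUR); those `@[conjecture]` defs stay in the tree as settled negative edges (append-only rule; no Lean `¬` is cheap — census-level);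
their own docstrings receive the «REFUTED in-engine — SUPERSEDED by `LocalCell.…`» paragraph at the next SUBSTANTIVE append to their files
(`ConwayKodairaLaws.lean` is at 396/400 lines and cannot take one; `IZeroStarInertiaLaws.lean` can) — until then this file and
HOME/CANDIDATES.md (DEAD-kept-by-rule rows) are the record.  E-desc-49 (`ImprimitiveTightIZeroStarFullLawAtTwo`, witness 1472f1/l1) is ONE
engine only — ref1 §R224 «hold pending D-desc-g29-1»: NOT marked refuted here beyond desc's own one-engine sentence above.
HONEST FRAMING: census laws, nothing proved about any curve; BSD / Manin c = 1 NOT proved; C2/C3 OPEN.  bears_on: stmt-BirchSwinnertonDyer-22967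
(C2 `ManinOddAtFour`, the 2-adic depth laws) / 22968 (C3, row g29-5 at 3).
-/

set_option autoImplicit false

noncomputable section

open scoped MatrixGroups ModularForm

open CongruenceSubgroup WeierstrassCurve Literature.NumberTheory.EllipticCurves.ModularForms
  Literature.NumberTheory.DiophantineGeometry

namespace Summit.BirchSwinnertonDyer.Rank1Residual.ManinAdditive.LocalCell

open ConwayCut RamanujanCut NeronOmegaThree

open scoped Classical

/-! ## Vocabulary (ℚ₂-local, E-facing; Néron-model typing through the tree's `goodReductionSubgroup`) -/

/-- The `ℤ₂`-minimal model of `W / ℚ₂` (Mathlib `WeierstrassCurve.minimal`; same object as inside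
`WeierstrassCurve.localTamagawaNumber`). -/
abbrev minimalModelAtTwo (W : WeierstrassCurve ℚ) : WeierstrassCurve ℚ_[2] :=
  (W.baseChange ℚ_[2]).minimal ℤ_[2]

/-- **ℚ₂-LOCAL identity-component 2-torsion**: the identity component `E⁰(ℚ₂) = E₀(ℚ₂)` (points of non-singular reduction of
the minimal model, tree decl `WeierstrassCurve.goodReductionSubgroup`) contains a `ℚ₂`-rational point of order `2`.  For
additive reduction at `2` this is the Kosters–Pannekoek class «always» (arXiv:1703.07888, Thm 1 / Cor 2: on the normalised
minimal model with all `aᵢ ∈ 2ℤ₂`, `(a₁/2, a₃/2) mod 2 ∈ {(1,0), (0,1)}`); the data seat's column `kp2` of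
`MANIN-ADDITIVE-CREMONA-TIER-v1.tsv.gz`.  Compare the GLOBAL `ConwayCut.HasTwoTorsionInIdentityComponentAtTwo` (a `ℚ`-rational
such point), which implies this. -/
def HasLocalTwoTorsionInIdentityComponentAtTwo (W : WeierstrassCurve ℚ) : Prop :=
  ∃ P : (minimalModelAtTwo W).toAffine.Point,
    P ≠ 0 ∧ 2 • P = 0 ∧ P ∈ (minimalModelAtTwo W).goodReductionSubgroup ℤ_[2]

/-- The local Tamagawa number `c₂ = [E(ℚ₂) : E⁰(ℚ₂)] = #Φ₂(𝔽₂)` (tree decl `WeierstrassCurve.localTamagawaNumber` at `ℤ₂`). -/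
def tamagawaNumberAtTwo (W : WeierstrassCurve ℚ) : ℕ :=
  (W.baseChange ℚ_[2]).localTamagawaNumber ℤ_[2]

/-- The FULL CELL of class A at `2`: `E⁰(ℚ₂)[2] ≠ 0` and `c₂ = 1` (no `𝔽₂`-rational non-identity component of the `I₀*`
fibre; equivalently `E(ℚ₂) = E⁰(ℚ₂)`).  In the census this cell is `{e₂ = 6 at 2⁴ ∥ N, e₂ = 8 at 2⁵ ∥ N} ∩ {c₂ = 1}`
= `{v₂(j) ∈ {3,4}} ∩ {c₂ = 1}`. -/
def IsClassAFullCellAtTwo (W : WeierstrassCurve ℚ) : Prop :=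
  HasLocalTwoTorsionInIdentityComponentAtTwo W ∧ tamagawaNumberAtTwo W = 1

/-! ## Candidate laws at `2` (nothing asserted; frame VERBATIM from `ConwayCut.ImprimitiveTightIZeroStarFullLawAtTwo`) -/

section LawsAtTwo

open scoped Classical

/-- **E-desc-g29-1 `ClassATwoAdicDichotomyAtTwo`** (EXACT law on class A; census 73 rows, `N ≤ 1632`, three engines:
FULL 15 = 416a1 464d1 464f1 608c1 800e1 800f1 848f1 864d1 864g1 976c1 1264c1 1264f1 1296g1 1296i1 1424d1, DEFECT 58; both
ranks on both sides — 848f1 976c1 1264f1 1424d1 are rank 1 and FULL): for an optimal curve of class A at `2`,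
`ord₂ [e_f S^G : ℤ f] = ord₂ deg φ ⟺ (E⁰(ℚ₂)[2] ≠ 0 ∧ c₂ = 1)`.
Why it might fail: a class-A curve at `2⁴·q` in the full cell whose odd congruences interact with the 2-part of `deg φ`
(`σ₂ = 1` in the cell), or a Kosters–Pannekoek «never» curve of class A with full plain depth beyond `N = 1632`
(the TIER table types 104 class-A optimal curves with `N ≤ 2000`; 31 of them — 1328c1 and `1584 ≤ N ≤ 1984` — have no `σ₂`
yet; pre-registered prediction MEMO-desc §54.11: `σ₂ = 0` exactly for 1696b1 1760c1 1760d1 1760m1).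
[sources: this census (MEMO-desc §54); Kosters–Pannekoek arXiv:1703.07888 Thm 1; Tate 1975 (Antwerp IV) §1 (`c_p`);
 imc MEMO-imc §24.11 (E-imc-131, the `R₄`-NEWDEFECT list = this cell)] -/
@[conjecture]
def ClassATwoAdicDichotomyAtTwo : Prop :=
  ∀ (W : WeierstrassCurve ℚ) [W.IsElliptic] [W.IsGloballyMinimal] [NeZero (W.conductorNorm ℤ)]
    (D : ModularParametrizationData W (W.conductorNorm ℤ)),
    (∀ z ∈ D.L.lattice, ∃ w ∈ periodLattice D.f, z = D.c * w) →
    (∀ (W' : WeierstrassCurve ℚ) [W'.IsElliptic]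
        (D' : ModularParametrizationData W' (W.conductorNorm ℤ)),
        D'.f = D.f → D.modularDegree ≤ D'.modularDegree) →
    4 ∣ W.conductorNorm ℤ → IsTorsionFreeIZeroStarAtTwo W →
      (padicValNat 2 (lineIndex (conwayStableLattice (W.conductorNorm ℤ)) D.f) =
          padicValNat 2 D.modularDegree ↔ IsClassAFullCellAtTwo W)

/-- **E-desc-g29-2 `IdentityTwoTorsionFullLawAtTwo`** (one-sided FULL law on every `I₀*` curve at `2`; census 21/21:
the 15 class-A full rows + the six curves with a `ℚ`-RATIONAL 2-torsion point in `E⁰(ℚ₂)` 48a1 80a1 80b1 208c1 464e1 848d1,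
i.e. g6's E-desc-31 is the `ℚ`-rational shadow of this row): `I₀*` at `2`, a `ℚ₂`-rational point of order 2 in the identity
component, and either `c₂ = 1` or that point may be taken `ℚ`-rational `⟹ ord₂ [e_f S^G : ℤ f] = ord₂ deg φ`
(hence, GIVEN E-desc-28♯ + `ConwayDepthTransfer` at `v₂(N) ≤ 3` resp. nothing Néron-facing at `16 ∣ N`, where `σ₂^R = 1`).
Why it might fail: a `Φ`-class curve (`c₂ = 2`, rational 2-torsion only through `Φ₂`) is correctly EXCLUDED (112b1 `σ₂ = 0`
vs 528d1 `σ₂ = 1` share the local cell); the risk is a full-cell class-A curve with `σ₂ = 1` beyond 1632, or an `E⁰`-torsion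
`I₀*` curve with `c₂ = 4`. [sources: as E-desc-g29-1; MEMO-desc §23 (E-desc-31)] -/
@[conjecture]
def IdentityTwoTorsionFullLawAtTwo : Prop :=
  ∀ (W : WeierstrassCurve ℚ) [W.IsElliptic] [W.IsGloballyMinimal] [NeZero (W.conductorNorm ℤ)]
    (D : ModularParametrizationData W (W.conductorNorm ℤ)),
    (∀ z ∈ D.L.lattice, ∃ w ∈ periodLattice D.f, z = D.c * w) →
    (∀ (W' : WeierstrassCurve ℚ) [W'.IsElliptic]
        (D' : ModularParametrizationData W' (W.conductorNorm ℤ)),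
        D'.f = D.f → D.modularDegree ≤ D'.modularDegree) →
    4 ∣ W.conductorNorm ℤ → W.kodairaSymbolAt placeTwo = .Istar 0 →
    HasLocalTwoTorsionInIdentityComponentAtTwo W →
    (tamagawaNumberAtTwo W = 1 ∨ HasTwoTorsionInIdentityComponentAtTwo W) →
      padicValNat 2 (lineIndex (conwayStableLattice (W.conductorNorm ℤ)) D.f) =
        padicValNat 2 D.modularDegree

/-- **E-desc-g29-3 `ClassANonIdentityCellDefectLawAtTwo`** (one-sided DEFECT law on class A; census 58/58 = Kosters–Pannekoek
«never» 50 (32 with `c₂ = 1`, among them the TIGHT dihedral curves 1472f1 1472l1 that kill E-desc-49, and 18 with `c₂ = 2`)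
+ «always» with `c₂ = 2` 8 (Tamagawa excess, = E-desc-46's sub-reading)): a class-A curve outside the full cell has
`ord₂ [e_f S^G : ℤ f] + 1 = ord₂ deg φ`.  Why it might fail: `σ₂ = 2` at a deep level (never observed; `σ₂ ≤ 1` is
E-desc-32), or a «never» class-A curve whose congruences all live inside `S^G`. [sources: as E-desc-g29-1] -/
@[conjecture]
def ClassANonIdentityCellDefectLawAtTwo : Prop :=
  ∀ (W : WeierstrassCurve ℚ) [W.IsElliptic] [W.IsGloballyMinimal] [NeZero (W.conductorNorm ℤ)]
    (D : ModularParametrizationData W (W.conductorNorm ℤ)),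
    (∀ z ∈ D.L.lattice, ∃ w ∈ periodLattice D.f, z = D.c * w) →
    (∀ (W' : WeierstrassCurve ℚ) [W'.IsElliptic]
        (D' : ModularParametrizationData W' (W.conductorNorm ℤ)),
        D'.f = D.f → D.modularDegree ≤ D'.modularDegree) →
    4 ∣ W.conductorNorm ℤ → IsTorsionFreeIZeroStarAtTwo W → ¬ IsClassAFullCellAtTwo W →
      padicValNat 2 (lineIndex (conwayStableLattice (W.conductorNorm ℤ)) D.f) + 1 =
        padicValNat 2 D.modularDegree

/-- GLUE (PROVED): the exact law E-desc-g29-1 is E-desc-g29-2 (restricted to class A) ∧ E-desc-g29-3. -/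
theorem classA_dichotomy_of_laws (hfull : IdentityTwoTorsionFullLawAtTwo)
    (hdef : ClassANonIdentityCellDefectLawAtTwo) : ClassATwoAdicDichotomyAtTwo := by
  intro W _ _ _ D hL hopt h4 hA
  constructor
  · intro hf
    by_contra hcell
    have hd := hdef W D hL hopt h4 hA hcell
    omega
  · intro hcell
    exact hfull W D hL hopt h4 hA.1 hcell.1 (Or.inl hcell.2)

/-- CONSEQUENCE (PROVED): g6's E-desc-31 shape — a `ℚ`-rational 2-torsion point in `E⁰(ℚ₂)` on an `I₀*` curve forces full
plain depth — follows from E-desc-g29-2 once the rational point is also read `ℚ₂`-locally (hypothesis `hloc`, the routine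
base change `E(ℚ) → E(ℚ₂)` preserving order 2 and non-singular reduction; not proved here). -/
theorem full_of_rational_identity_torsion (hfull : IdentityTwoTorsionFullLawAtTwo)
    (W : WeierstrassCurve ℚ) [W.IsElliptic] [W.IsGloballyMinimal] [NeZero (W.conductorNorm ℤ)]
    (D : ModularParametrizationData W (W.conductorNorm ℤ))
    (hL : ∀ z ∈ D.L.lattice, ∃ w ∈ periodLattice D.f, z = D.c * w)
    (hopt : ∀ (W' : WeierstrassCurve ℚ) [W'.IsElliptic]
        (D' : ModularParametrizationData W' (W.conductorNorm ℤ)),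
        D'.f = D.f → D.modularDegree ≤ D'.modularDegree)
    (h4 : 4 ∣ W.conductorNorm ℤ) (hI : W.kodairaSymbolAt placeTwo = .Istar 0)
    (hrat : HasTwoTorsionInIdentityComponentAtTwo W)
    (hloc : HasTwoTorsionInIdentityComponentAtTwo W → HasLocalTwoTorsionInIdentityComponentAtTwo W) :
    padicValNat 2 (lineIndex (conwayStableLattice (W.conductorNorm ℤ)) D.f) = padicValNat 2 D.modularDegree :=
  hfull W D hL hopt h4 hI (hloc hrat) (Or.inr hrat)

/-- **E-desc-g29-4 `PhiClassRankDefectLawAtTwo`** (REPAIR of the refuted E-desc-44′: the rank law survives on the `Φ`-CLASS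
— residual class WITH rational 2-torsion, none of it in `E⁰(ℚ₂)`; census on `I₀*`: loose `Φ`-class rows 28/28 defect
(rank ≥ 1: 14/14), `N ≤ 1632`; on the `Iₙ*` part of the residual class E-desc-44′ had 31/31 ≤ 612 + 944a1/b1): a point of
infinite order forces `ord₂ [e_f S^G : ℤ f] + 1 = ord₂ deg φ`.  Why it might fail: exactly as E-desc-44′ failed on class A —
a `Φ`-class curve whose rank halving of `deg φ` already sits inside `r_G` (e.g. a `Φ`-class twist of 848f1).
[sources: MEMO-desc §23 (E-desc-44), §54; Watkins 2002 Exp. Math. 11 §4 doi:10.1080/10586458.2002.10504701 (shape)] -/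
@[conjecture]
def PhiClassRankDefectLawAtTwo : Prop :=
  ∀ (W : WeierstrassCurve ℚ) [W.IsElliptic] [W.IsGloballyMinimal] [NeZero (W.conductorNorm ℤ)]
    (D : ModularParametrizationData W (W.conductorNorm ℤ)),
    (∀ z ∈ D.L.lattice, ∃ w ∈ periodLattice D.f, z = D.c * w) →
    (∀ (W' : WeierstrassCurve ℚ) [W'.IsElliptic]
        (D' : ModularParametrizationData W' (W.conductorNorm ℤ)),
        D'.f = D.f → D.modularDegree ≤ D'.modularDegree) →
    4 ∣ W.conductorNorm ℤ → IsResidualAtTwo W → HasRationalTwoTorsion W → 0 < W.mordellWeilRank →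
      padicValNat 2 (lineIndex (conwayStableLattice (W.conductorNorm ℤ)) D.f) + 1 =
        padicValNat 2 D.modularDegree

/-- GLUE (PROVED, bookkeeping): the refuted E-desc-44′ is E-desc-g29-4 on the `Φ`-class plus its (false) class-A
restriction; i.e. E-desc-44′ ⟹ E-desc-g29-4 — the repair is a WEAKENING, so nothing already built on E-desc-44′ off
class A is lost. -/
theorem phiClassRank_of_residualRank (h : ResidualRankDefectLawAtTwo') : PhiClassRankDefectLawAtTwo := by
  intro W _ _ _ D hL hopt h4 hres _ hrk
  exact h W D hL hopt h4 hres hrk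

end LawsAtTwo

/-! ## Candidate law at `3` (nothing asserted; frame VERBATIM from `RamanujanCut.ResidualRankDefectLawAtThree`) -/

/-- «3-TIGHT»: Mordell–Weil rank `0` and no 3-adic Tamagawa excess over the torsion order (twin of `ConwayCut.IsTwoTight`). -/
def IsThreeTight (W : WeierstrassCurve ℚ) : Prop :=
  W.mordellWeilRank = 0 ∧ padicValNat 3 W.tamagawaProduct ≤ padicValNat 3 W.torsionOrder

section LawsAtThree

open scoped Classical

/-- **E-desc-g29-5 `ResidualTightDichotomyAtThree`** (EXACT law on the residual class at `3` = Kodaira IV* at `3` with a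
rational point of order 3 (then through `Φ₃`, Kosters–Pannekoek «never»); census 9 rows `N ≤ 918`, two engines ≤ 612
(MS-0, sigma.gp v2) and one beyond: FULL = 27a1 54a1 270a1 459f1 594c1 (rank 0, `∏c_q = 3 = #tors`), DEFECT = 540c1 540d1
918i1 918j1 (rank 1 AND `v₃ ∏c_q = 2 > 1`)): `ord₃ [e_f S^R : ℤ f] = ord₃ deg φ ⟺` 3-tight.  It packages E-desc-45 (rank)
with its Tamagawa twin; the census cannot separate the two readings (every defect row has both).  THIN (9 rows).
Why it might fail: a rank-0 residual curve at `27·q` with `c_q = 3` at an odd prime and full depth (the Tamagawa reading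
would fail, the rank reading not), or a tight residual curve beyond 918 with `σ₃ = 1` (`ℚ₃^{nr}`-twist classes of
27a1/54a1 predict `σ₃ = 0` for every tight unit twist — none is `X₀`-optimal of type IV* below 1521).
[sources: MEMO-desc §23 (E-desc-45), §54; Kosters–Pannekoek arXiv:1703.07888 (κ₃)] -/
@[conjecture]
def ResidualTightDichotomyAtThree : Prop :=
  ∀ (W : WeierstrassCurve ℚ) [W.IsElliptic] [W.IsGloballyMinimal] [NeZero (W.conductorNorm ℤ)]
    (D : ModularParametrizationData W (W.conductorNorm ℤ)),
    (∀ z ∈ D.L.lattice, ∃ w ∈ periodLattice D.f, z = D.c * w) →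
    (∀ (W' : WeierstrassCurve ℚ) [W'.IsElliptic]
        (D' : ModularParametrizationData W' (W.conductorNorm ℤ)),
        D'.f = D.f → D.modularDegree ≤ D'.modularDegree) →
    9 ∣ W.conductorNorm ℤ → W.kodairaSymbolAt placeThree = .IVstar → HasRationalThreeTorsion W →
      (padicValNat 3 (lineIndex (ramanujanStableLattice (W.conductorNorm ℤ)) D.f) =
          padicValNat 3 D.modularDegree ↔ IsThreeTight W)

/-- GLUE (PROVED): E-desc-g29-5 implies the rank half E-desc-45 on Kodaira IV* in the tree's Mordell–Weil currency
(a curve of positive rank is not 3-tight, so the dichotomy puts it on the defect side; `σ₃ ≤ 1` is supplied as the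
hypothesis `hle`, E-desc-32's twin, since the `↔` alone does not bound the defect). -/
theorem rank_defect_of_dichotomy_IVstar (h : ResidualTightDichotomyAtThree)
    (W : WeierstrassCurve ℚ) [W.IsElliptic] [W.IsGloballyMinimal] [NeZero (W.conductorNorm ℤ)]
    (D : ModularParametrizationData W (W.conductorNorm ℤ))
    (hL : ∀ z ∈ D.L.lattice, ∃ w ∈ periodLattice D.f, z = D.c * w)
    (hopt : ∀ (W' : WeierstrassCurve ℚ) [W'.IsElliptic]
        (D' : ModularParametrizationData W' (W.conductorNorm ℤ)),
        D'.f = D.f → D.modularDegree ≤ D'.modularDegree)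
    (h9 : 9 ∣ W.conductorNorm ℤ) (hIV : W.kodairaSymbolAt placeThree = .IVstar) (h3 : HasRationalThreeTorsion W)
    (hrk : 0 < W.mordellWeilRank)
    (hle : padicValNat 3 (lineIndex (ramanujanStableLattice (W.conductorNorm ℤ)) D.f) ≤ padicValNat 3 D.modularDegree ∧
      padicValNat 3 D.modularDegree ≤ padicValNat 3 (lineIndex (ramanujanStableLattice (W.conductorNorm ℤ)) D.f) + 1) :
    padicValNat 3 (lineIndex (ramanujanStableLattice (W.conductorNorm ℤ)) D.f) + 1 = padicValNat 3 D.modularDegree := by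
  have hiff := h W D hL hopt h9 hIV h3
  have hnt : ¬ IsThreeTight W := fun ht => by
    have := ht.1; omega
  have hne : padicValNat 3 (lineIndex (ramanujanStableLattice (W.conductorNorm ℤ)) D.f) ≠ padicValNat 3 D.modularDegree :=
    fun he => hnt (hiff.mp he)
  omega

end LawsAtThree

end Summit.BirchSwinnertonDyer.Rank1Residual.ManinAdditive.LocalCell

end
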